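import Summits.SmoothPoincare4.SmoothPoincare4.Theorems.SullivanDualAdmissibleJExistsOfFraming
import Literature.Topology.FourManifolds.HomotopySphereFourTangentClutching

/-!
# Route SullivanDual, support item `AdmissibleJExists` (stmt-SmoothPoincare4-7830), IV:
# the conditional closure over the named fact

`AdmissibleJExists` for EVERY homotopy 4-sphere from the named fact
`Literature.Topology.FourManifolds.tangentFrame_homotopySphereFour_eq_invertedChartFrame` (the
tangent bundle of a homotopy 4-sphere has the clutching class of `TS⁴`, frame form;
`Literature/Topology/FourManifolds/HomotopySphereFourTangentClutching.lean`), by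
`exists_admissibleJ_of_frame` (`SullivanDualAdmissibleJExistsOfFraming.lean`); and the fact from
"every homotopy 4-sphere is diffeomorphic to `S⁴`", by
`tangentFrame_invertedChart_of_nonempty_diffeomorph_sphere` (ibid.). Pure logic given those.
-/

-- the registered namespace `Summit.SmoothPoincare4.SmoothPoincare4.Theorems` repeats a component
set_option linter.dupNamespace false

open scoped Manifold ContDiff Topology ContinuousMap

namespace Summit.SmoothPoincare4.SmoothPoincare4.Theorems.SullivanDual

open Literature.Geometry.Symplectic Literature.Topology.FourManifolds

/-- **`AdmissibleJExists` follows from the topological input**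
`Literature.Topology.FourManifolds.tangentFrame_homotopySphereFour_eq_invertedChartFrame` (the
tangent bundle of a homotopy 4-sphere has the clutching function of `TS⁴`, frame form): conjugate
`J₀` by the dual coframe of the frame it provides (`exists_admissibleJ_of_frame`). Conditional
closure of stmt-SmoothPoincare4-7830. [folklore] -/
theorem admissibleJExists_of_tangentFrame
    (h : tangentFrame_homotopySphereFour_eq_invertedChartFrame) :
    Theses.SullivanDual.AdmissibleJExists := by
  intro S p
  obtain ⟨e⟩ := S.nonempty_homotopyEquiv
  obtain ⟨ε, s, hε, hs, hli, hstd⟩ := h S.carrier e p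
  exact exists_admissibleJ_of_frame p hε s hs hli hstd

/-- The topological input follows from "every homotopy 4-sphere is diffeomorphic to `S⁴`"
(consistency of the named fact with the smooth Poincaré conjecture; it holds for the standard
sphere and every `M ≅ S⁴`, `tangentFrame_invertedChart_of_nonempty_diffeomorph_sphere`).
[folklore] -/
theorem tangentFrameFact_of_forall_nonempty_diffeomorph_sphere
    (h : ∀ (M : Type) [TopologicalSpace M] [T2Space M] [SecondCountableTopology M]
      [ChartedSpace (EuclideanSpace ℝ (Fin 4)) M] [IsManifold (𝓡 4) ∞ M],
      M ≃ₕ Metric.sphere (0 : EuclideanSpace ℝ (Fin 5)) 1 →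
        Nonempty (M ≃ₘ⟮𝓡 4, 𝓡 4⟯ Metric.sphere (0 : EuclideanSpace ℝ (Fin 5)) 1)) :
    tangentFrame_homotopySphereFour_eq_invertedChartFrame :=
  fun M _ _ _ _ _ e q => tangentFrame_invertedChart_of_nonempty_diffeomorph_sphere M (h M e) q

/-- In particular `AdmissibleJExists` follows from the smooth Poincaré conjecture in homotopy-sphere
form through the named fact (the same conclusion as
`admissibleJExists_of_forall_nonempty_diffeomorph_sphere`, routed through the topological input).
[folklore] -/
theorem admissibleJExists_of_forall_nonempty_diffeomorph_sphere'
    (h : ∀ (M : Type) [TopologicalSpace M] [T2Space M] [SecondCountableTopology M]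
      [ChartedSpace (EuclideanSpace ℝ (Fin 4)) M] [IsManifold (𝓡 4) ∞ M],
      M ≃ₕ Metric.sphere (0 : EuclideanSpace ℝ (Fin 5)) 1 →
        Nonempty (M ≃ₘ⟮𝓡 4, 𝓡 4⟯ Metric.sphere (0 : EuclideanSpace ℝ (Fin 5)) 1)) :
    Theses.SullivanDual.AdmissibleJExists :=
  admissibleJExists_of_tangentFrame (tangentFrameFact_of_forall_nonempty_diffeomorph_sphere h)

end Summit.SmoothPoincare4.SmoothPoincare4.Theorems.SullivanDual
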